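import Literature.MathematicalPhysics.QuantumFieldTheory.Balaban1983to89.B9Eq315QSingleBondLetter
import Literature.MathematicalPhysics.QuantumFieldTheory.Balaban1983to89.B9Eq315QkLocalLetter

/-!
# `Balaban1983to89.B9Eq315QkSingleBondLetter` — T. Bałaban, *Propagators for lattice gauge theories in a background field*, Commun. Math. Phys. **99**
# (1985) 389–434 [Balaban1985BackgroundPropagators] (3.15)–(3.16) p. 393 *«Q_j(U) … compositions of j one-step averaging operators»*, (3.26) p. 395, with
# [Balaban1985Averaging] (124)–(127) pp. 36–37, p. 24: **THE SHARP SINGLE-BOND LETTER OF THE COMPOSITE AVERAGING `Q_k(U)` — the `ℓ¹ → ℓ¹` letter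
# `Σ_c ‖(Q_k(U)A)(c)‖ ≤ ∏_{j<k}(L^{−d} + 100d(d+1)α_j)·Σ_b ‖A(b)‖`, hence `‖(Q_k(U)δ_b^X)(c)‖ ≤ L^{−kd}·e^{100d(d+1)L^d·A}·‖X‖` under a summable loop window
# `Σ_{j<k} α_j ≤ A` — ONE constant for every height `k`; on the chain's carriers `k_{Q,k} = M_φ′M_φ·L^{−(n+1)d}·e^{100d(d+1)L^dA}`, so that the adjoint's local
# letter reads `(c₁∕c₀)·k_{Q,k} = M_φ′M_φ·e^{100d(d+1)L^dA}` on the diagonal `c₀(L^{n+1})^d = c₁` (NO power of the height) and the penalty `Q_k†(a•Q_k)` has print's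
# pointwise size `O(|a|)` against the local values of `Q_kv`** — the tower twin of ne9-leaf-03 g78's `B9Eq315QSingleBondLetter` (t4-ne9-idea-1 L-g150-7 (ii):
# «NEVER instantiate §1 at the tower `Q_k`» with the crude `k`; this is the letter that may be instantiated there)

statement-level skeleton of published theorems with citation tags; proofs where landed; nothing here is a claim about the Yang–Mills mass gap

CITATION HEADER (lean-in-tree rule).  Audit cell `pub-balaban`, sub-cell `t4`, BINDER row NE9; filed by NE9 crux-team LEAF PROVER 03 (`b2b-balaban-t4-ne9-formalise-leaf-03`,
gen 78; road ΔA-CT, OFFER O-leaf03-g78-1 (W-1 (c)(i)) toward beta-an4's INTERFACE REQUEST D4).  Imports this lineage's `B9Eq315QSingleBondLetter` (the one-step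
`ℓ¹ → ℓ¹` letter `sum_norm_QtorusLin_le`) and `B9Eq315QkLocalLetter` (`QkOfU_apply_eq_zero_of_support`: the composite has range ONE big block; through it
`B9Eq315QTower` (`Qtower`, `Qtower_succ`, `QkOfU`), `B9Eq326OperatorTower.QkW`, `B9Eq383QSemiLocal.card_near_le`); ne9-leaf-05's generic local duality
`B9Eq316PenaltyLocalLetter.norm_adjoint_apply_le_local` through the first import.  Sources READ first-hand in the held text layers
(`paper:balaban1985-cmp99-background-propagators` p. 393 (3.15)–(3.16); `paper:balaban1985-cmp98-averaging` p. 36 (124)–(126), p. 24 «this definition is local»).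
NOTHING of print's proofs is reproduced; [folklore] induction over the levels + composition BY NAME.

WHAT IS PROVED (sorry-free; proof lane — 0 `def`; [folklore]).
* §1 (`𝔸`-valued, any level family `Ulev` with loop letters `α_j ∈ [0, 1∕64]`) **`sum_norm_Qtower_le`** (the `ℓ¹ → ℓ¹` letter of the composite, by induction on
  `Qtower_succ`), `prod_level_le` (`∏_{j<k}(L^{−d} + 100d(d+1)α_j) ≤ (L^{−d})^k·e^{100d(d+1)L^d·Σ_{j<k}α_j}`), **`norm_Qtower_single_le`**.
* §2 (one background `U` on `T_{L^k m}`) **`norm_QkOfU_single_le_heightFree`** — `‖(Q_k(U)δ_b^X)(c)‖ ≤ ((L^k)^d)⁻¹·e^{100d(d+1)L^dA}·‖X‖` given `Σ_{j<k}α_j ≤ A`.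
* §3 (the chain's carriers, `k = n+1`) `equiv_QkW_apply` (unfolding), **`norm_QkW_single_le`** (the sharp tower `k_{Q,k}`), **`equiv_QkW_single_eq_zero`** (off the
  zone), **`norm_adjoint_QkW_apply_le_local_sharp`** (`‖(Q_k†h)(b)‖ ≤ (c₁∕c₀)·k_{Q,k}·2d·M` from `‖h(c)‖ ≤ M` on the ≤ `2d` zone bonds),
  **`norm_penalty_QkW_apply_le_local_of_values`** (`‖((Q_k†(a•Q_k))v)(b)‖ ≤ |a|·(c₁∕c₀)·k_{Q,k}·2d·M` from `‖(Q_kv)(c)‖ ≤ M` on the zone),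
  **`…_of_values_diagonal`** (`c₀(L^{n+1})^d = c₁`: `≤ |a|·M_φ′M_φ·e^{100d(d+1)L^dA}·2d·M` — HEIGHT-FREE).
HONEST SCOPE.  Composition; the defect brackets are paid at the crude one-step rate, whence the loop window `Σ_j α_j ≤ A` with `L^d` in the exponent (crude
but height-free); the block-`L²` reading of the zone values `‖(Q_kv)(c)‖` (the stencil letter `p₂` of the local part's penalty) is the next file; nothing of
[B9] Thm 3.1∕3.3 asserted; «NE9 ⇐ the named binders»; NE9 NOT PRINTED ∕ NOT PROVED; row WALLED ON A MODEL (O-NE9-1; #5 UNRULED); spine PROVED 0∕9; rung (B)+1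
on a finite T⁴ — NOT infinite volume, NOT mass gap, NOT BetaPertH, NOT Clay.  HONEST DEPENDENCY: continuum YM on T⁴ ⇐ BetaPertH ∧ nine spine estimates (0/9
proved); BetaPertH ⇐ (D1) ∧ (D4) ∧ CAP+tail; G-an2-4 gates asym, D1 and NE2/3/4.  NEW file; nothing modified.  Net new unproved facts: 0.
-/

noncomputable section

open scoped BigOperators

namespace Literature.MathematicalPhysics.QuantumFieldTheory.Balaban1983to89.B9Eq315QkSingleBondLetter

open B4Sect5Torus (TSite)
open B9SectCLatticeCarrier (Bond shift)
open B9Eq311L2Pairing (WL2)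
open B11Eq103H1Complex (BondL2K)
open B9Eq319QprimeTorus (fineP blockCoord)
open B7Prop1Explicit (U1 Wcx boxVec)
open B9Eq315QTorus (perCfg cornerSite QtorusLin)
open B9Eq315QTower (towerP Qtower Qtower_zero Qtower_succ UlevOf QkOfU)
open B9Eq316TowerFlatIsOneStep (towerP_eq_fineP_pow siteCast)
open B9Eq326OperatorTower (QkW)
open B9Eq383QSemiLocal (card_near_le)
open B9Eq315QkLocalLetter (QkOfU_apply_eq_zero_of_support)
open B9Eq316PenaltyLocalLetter (norm_adjoint_apply_le_local)
open B9Eq315QSingleBondLetter (sum_norm_QtorusLin_le)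

/-! ## §1 The `ℓ¹ → ℓ¹` letter of the composite, by induction over the levels -/

section Tower

variable {d : ℕ} (L : ℕ) [NeZero L] (m : Fin d → ℕ) [∀ i, NeZero (m i)]
  {𝔸 : Type*} [NormedRing 𝔸] [NormedAlgebra ℂ 𝔸] [CompleteSpace 𝔸] [NormOneClass 𝔸] (hL : 1 ≤ L)
  (Ulev : (n : ℕ) → Bond d (towerP L m (n + 1)) → 𝔸ˣ) (α : ℕ → ℝ) (hα0 : ∀ n, 0 ≤ α n) (hα1 : ∀ n, α n ≤ 1 / 64)
  (hU1 : ∀ (n : ℕ) (x : B7Prop1Explicit.Site d) (κ : Fin d), perCfg (towerP L m (n + 1)) (Ulev n) x κ ∈ U1 𝔸)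
  (hreg : ∀ (n : ℕ) (y : TSite d (towerP L m n)) (κ : Fin d) (r : Fin d → Fin L),
    ‖((Wcx L (perCfg (towerP L m (n + 1)) (Ulev n)) (cornerSite L y) κ (boxVec L r) : 𝔸ˣ) : 𝔸) - 1‖ ≤ α n)

include hα0 in
/-- **THE `ℓ¹ → ℓ¹` LETTER OF THE COMPOSITE AVERAGING**: `Σ_c ‖(Q_n A)(c)‖ ≤ ∏_{j<n}(L^{−d} + 100d(d+1)α_j)·Σ_b ‖A(b)‖` — `Q_{n+1} = Q_n ∘ Q(U_n)` (finest
factor first, `Qtower_succ`) and the one-step letter `B9Eq315QSingleBondLetter.sum_norm_QtorusLin_le` at every level. [folklore]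
[cite: Balaban1985BackgroundPropagators, (3.15)–(3.16) p.393; Balaban1985Averaging, (124)–(127) pp.36–37] -/
theorem sum_norm_Qtower_le : ∀ (n : ℕ) (A : Bond d (towerP L m n) → 𝔸),
    ∑ c : Bond d m, ‖Qtower L m hL Ulev α hα1 hU1 hreg n A c‖ ≤
      (∏ j ∈ Finset.range n, ((((L : ℝ) ^ d)⁻¹ + 100 * d * (d + 1) * α j))) * ∑ b, ‖A b‖
  | 0, A => by rw [Qtower_zero, Finset.prod_range_zero, one_mul]; exact le_rfl
  | n + 1, A => by
    rw [Qtower_succ, Finset.prod_range_succ]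
    have ih := sum_norm_Qtower_le n (QtorusLin L (towerP L m n) hL (Ulev n) (hα1 n) (hU1 n) (hreg n) A)
    have h1 := sum_norm_QtorusLin_le L (towerP L m n) hL (Ulev n) (hα1 n) (hU1 n) (hreg n) A
    have hP : 0 ≤ ∏ j ∈ Finset.range n, (((L : ℝ) ^ d)⁻¹ + 100 * d * (d + 1) * α j) :=
      Finset.prod_nonneg fun j _ => by have := hα0 j; positivity
    calc ∑ c : Bond d m, ‖Qtower L m hL Ulev α hα1 hU1 hreg n (QtorusLin L (towerP L m n) hL (Ulev n) (hα1 n) (hU1 n) (hreg n) A) c‖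
        ≤ (∏ j ∈ Finset.range n, (((L : ℝ) ^ d)⁻¹ + 100 * d * (d + 1) * α j)) *
            ∑ c', ‖QtorusLin L (towerP L m n) hL (Ulev n) (hα1 n) (hU1 n) (hreg n) A c'‖ := ih
      _ ≤ (∏ j ∈ Finset.range n, (((L : ℝ) ^ d)⁻¹ + 100 * d * (d + 1) * α j)) *
            (((((L : ℝ) ^ d)⁻¹ + 100 * d * (d + 1) * α n)) * ∑ b, ‖A b‖) := mul_le_mul_of_nonneg_left h1 hP
      _ = (∏ j ∈ Finset.range n, (((L : ℝ) ^ d)⁻¹ + 100 * d * (d + 1) * α j)) * ((((L : ℝ) ^ d)⁻¹ + 100 * d * (d + 1) * α n)) *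
            ∑ b, ‖A b‖ := by ring

include hL hα0 in
omit [NeZero L] in
/-- **THE LEVEL PRODUCT UNDER A SUMMABLE LOOP WINDOW**: `∏_{j<n}(L^{−d} + 100d(d+1)α_j) ≤ (L^{−d})^n·e^{100d(d+1)L^d·Σ_{j<n}α_j}` (`1 + t ≤ e^t`). [folklore]
[cite: Balaban1985Averaging, (126)–(127) pp.36–37; Balaban1985BackgroundPropagators, (3.35)–(3.37) p.396] -/
theorem prod_level_le (n : ℕ) :
    ∏ j ∈ Finset.range n, (((L : ℝ) ^ d)⁻¹ + 100 * d * (d + 1) * α j) ≤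
      (((L : ℝ) ^ d)⁻¹) ^ n * Real.exp (100 * d * (d + 1) * (L : ℝ) ^ d * ∑ j ∈ Finset.range n, α j) := by
  have hLd : (0 : ℝ) < (L : ℝ) ^ d := by
    have : (0 : ℝ) < L := by exact_mod_cast hL
    positivity
  have hfac : ∀ j, (((L : ℝ) ^ d)⁻¹ + 100 * d * (d + 1) * α j) =
      ((L : ℝ) ^ d)⁻¹ * (1 + 100 * d * (d + 1) * (L : ℝ) ^ d * α j) := fun j => by field_simp
  have hle : ∀ j, (((L : ℝ) ^ d)⁻¹ + 100 * d * (d + 1) * α j) ≤ ((L : ℝ) ^ d)⁻¹ * Real.exp (100 * d * (d + 1) * (L : ℝ) ^ d * α j) := fun j => by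
    rw [hfac j]
    refine mul_le_mul_of_nonneg_left ?_ (by positivity)
    have h := Real.add_one_le_exp (100 * d * (d + 1) * (L : ℝ) ^ d * α j)
    linarith
  calc ∏ j ∈ Finset.range n, (((L : ℝ) ^ d)⁻¹ + 100 * d * (d + 1) * α j)
      ≤ ∏ j ∈ Finset.range n, ((L : ℝ) ^ d)⁻¹ * Real.exp (100 * d * (d + 1) * (L : ℝ) ^ d * α j) :=
        Finset.prod_le_prod (fun j _ => by have := hα0 j; positivity) fun j _ => hle j
    _ = (((L : ℝ) ^ d)⁻¹) ^ n * Real.exp (100 * d * (d + 1) * (L : ℝ) ^ d * ∑ j ∈ Finset.range n, α j) := by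
        rw [Finset.prod_mul_distrib, Finset.prod_const, Finset.card_range, ← Real.exp_sum, Finset.mul_sum]

include hα0 in
/-- **THE SHARP SINGLE-BOND LETTER OF THE COMPOSITE, `𝔸`-valued**: `‖(Q_n δ_b^X)(c)‖ ≤ ∏_{j<n}(L^{−d} + 100d(d+1)α_j)·‖X‖` (one term of the column sum;
`Σ_{b′} ‖δ_b^X(b′)‖ = ‖X‖`). [folklore] [cite: Balaban1985BackgroundPropagators, (3.15)–(3.16) p.393; Balaban1985Averaging, (125)–(127) pp.36–37] -/
theorem norm_Qtower_single_le (n : ℕ) [DecidableEq (Bond d (towerP L m n))] (b : Bond d (towerP L m n)) (X : 𝔸) (c : Bond d m) :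
    ‖Qtower L m hL Ulev α hα1 hU1 hreg n (Pi.single b X) c‖ ≤ (∏ j ∈ Finset.range n, (((L : ℝ) ^ d)⁻¹ + 100 * d * (d + 1) * α j)) * ‖X‖ := by
  have hsum : ∑ b', ‖(Pi.single b X : Bond d (towerP L m n) → 𝔸) b'‖ = ‖X‖ := by
    rw [Finset.sum_eq_single b (fun b' _ hb' => by rw [Pi.single_eq_of_ne hb', norm_zero]) (fun h => (h (Finset.mem_univ _)).elim),
      Pi.single_eq_same]
  have h := sum_norm_Qtower_le L m hL Ulev α hα0 hα1 hU1 hreg n (Pi.single b X)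
  rw [hsum] at h
  exact (Finset.single_le_sum (f := fun c => ‖Qtower L m hL Ulev α hα1 hU1 hreg n (Pi.single b X) c‖) (fun c _ => norm_nonneg _)
    (Finset.mem_univ c)).trans h

end Tower

/-! ## §2 One background on `T_{L^k m}`: the height-free form -/

section OneBackground

variable {d : ℕ} (L : ℕ) [NeZero L] (m : Fin d → ℕ) [∀ i, NeZero (m i)]
  {𝔸 : Type*} [NormedRing 𝔸] [NormedAlgebra ℂ 𝔸] [CompleteSpace 𝔸] [NormOneClass 𝔸] (hL : 1 ≤ L) (k : ℕ) (U : Bond d (towerP L m k) → 𝔸ˣ)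
  (α : ℕ → ℝ) (hα0 : ∀ n, 0 ≤ α n) (hα1 : ∀ n, α n ≤ 1 / 64)
  (hU1 : ∀ (n : ℕ) (x : B7Prop1Explicit.Site d) (κ : Fin d), perCfg (towerP L m (n + 1)) (UlevOf L m k U n) x κ ∈ U1 𝔸)
  (hreg : ∀ (n : ℕ) (y : TSite d (towerP L m n)) (κ : Fin d) (r : Fin d → Fin L),
    ‖((Wcx L (perCfg (towerP L m (n + 1)) (UlevOf L m k U n)) (cornerSite L y) κ (boxVec L r) : 𝔸ˣ) : 𝔸) - 1‖ ≤ α n)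

include hα0 in
/-- **`Q_k(U)` ON A SPIKE, HEIGHT-FREE**: `Σ_{j<k} α_j ≤ A` ⟹ `‖(Q_k(U)δ_b^X)(c)‖ ≤ ((L^k)^d)⁻¹·e^{100d(d+1)L^d·A}·‖X‖` — ONE constant for every number of levels.
[folklore] [cite: Balaban1985BackgroundPropagators, (3.15)–(3.16) p.393, (3.35)–(3.37) p.396; Balaban1985Averaging, (125)–(127) pp.36–37] -/
theorem norm_QkOfU_single_le_heightFree [DecidableEq (Bond d (towerP L m k))] {A : ℝ} (hA : ∑ j ∈ Finset.range k, α j ≤ A)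
    (b : Bond d (towerP L m k)) (X : 𝔸) (c : Bond d m) :
    ‖QkOfU L m hL k U α hα1 hU1 hreg (Pi.single b X) c‖ ≤ (((L : ℝ) ^ k) ^ d)⁻¹ * Real.exp (100 * d * (d + 1) * (L : ℝ) ^ d * A) * ‖X‖ := by
  have h1 := norm_Qtower_single_le L m hL (UlevOf L m k U) α hα0 hα1 hU1 hreg k b X c
  have h2 := prod_level_le (d := d) L hL α hα0 k
  have h3 : Real.exp (100 * d * (d + 1) * (L : ℝ) ^ d * ∑ j ∈ Finset.range k, α j) ≤ Real.exp (100 * d * (d + 1) * (L : ℝ) ^ d * A) :=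
    Real.exp_le_exp.mpr (mul_le_mul_of_nonneg_left hA (by positivity))
  have hpow : (((L : ℝ) ^ d)⁻¹) ^ k = (((L : ℝ) ^ k) ^ d)⁻¹ := by rw [inv_pow, ← pow_mul, ← pow_mul, mul_comm]
  calc ‖QkOfU L m hL k U α hα1 hU1 hreg (Pi.single b X) c‖
      ≤ (∏ j ∈ Finset.range k, (((L : ℝ) ^ d)⁻¹ + 100 * d * (d + 1) * α j)) * ‖X‖ := h1
    _ ≤ ((((L : ℝ) ^ d)⁻¹) ^ k * Real.exp (100 * d * (d + 1) * (L : ℝ) ^ d * A)) * ‖X‖ :=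
        mul_le_mul_of_nonneg_right (h2.trans (mul_le_mul_of_nonneg_left h3 (by positivity))) (norm_nonneg _)
    _ = (((L : ℝ) ^ k) ^ d)⁻¹ * Real.exp (100 * d * (d + 1) * (L : ℝ) ^ d * A) * ‖X‖ := by rw [hpow]

end OneBackground

/-! ## §3 On the chain's carriers at `k = n+1` levels: the sharp `k_{Q,k}`, the adjoint and the penalty from local values -/

section Fibre

variable {𝔸 : Type*} [NormedRing 𝔸] [NormedAlgebra ℂ 𝔸] {W : Type*} [NormedAddCommGroup W] [InnerProductSpace ℂ W] (φ : W ≃ₗ[ℂ] 𝔸) {c₀ : ℝ}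

/-- The fibre map reads a spike as a spike: `φ ∘ δ_b^u = δ_b^{φu}` (any finite carrier). [folklore] [cite: Balaban1985BackgroundPropagators, (3.15) p.393] -/
theorem comp_single_eq {X : Type*} [Fintype X] [DecidableEq X] (b : X) (u : W) :
    (fun b' => φ (WL2.equiv ℂ (fun _ : X => c₀) W ((WL2.equiv ℂ (fun _ : X => c₀) W).symm (Pi.single b u)) b')) = Pi.single b (φ u) := by
  funext b'
  rw [Equiv.apply_symm_apply]
  by_cases h : b' = b
  · rw [h, Pi.single_eq_same, Pi.single_eq_same]
  · rw [Pi.single_eq_of_ne h, Pi.single_eq_of_ne h, map_zero]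

end Fibre

section Carrier

variable {d : ℕ} (L : ℕ) [NeZero L] (m : Fin d → ℕ) [∀ i, NeZero (m i)] (n : ℕ)
  {𝔸 : Type*} [NormedRing 𝔸] [NormedAlgebra ℂ 𝔸] [CompleteSpace 𝔸] [NormOneClass 𝔸]
  {W : Type*} [NormedAddCommGroup W] [InnerProductSpace ℂ W] (φ : W ≃ₗ[ℂ] 𝔸) {c₀ c₁ : ℝ} [Fact (0 < c₀)] [Fact (0 < c₁)]
  (U : Bond d (towerP L m (n + 1)) → 𝔸ˣ) (hL : 1 ≤ L) (α : ℕ → ℝ) (hα0 : ∀ j, 0 ≤ α j) (hα1 : ∀ j, α j ≤ 1 / 64)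
  (hU1 : ∀ (j : ℕ) (x : B7Prop1Explicit.Site d) (κ : Fin d), perCfg (towerP L m (j + 1)) (UlevOf L m (n + 1) U j) x κ ∈ U1 𝔸)
  (hreg : ∀ (j : ℕ) (y : TSite d (towerP L m j)) (κ : Fin d) (r : Fin d → Fin L),
    ‖((Wcx L (perCfg (towerP L m (j + 1)) (UlevOf L m (n + 1) U j)) (cornerSite L y) κ (boxVec L r) : 𝔸ˣ) : 𝔸) - 1‖ ≤ α j)
  {Mφ Mφ' : ℝ} (hMφ : 0 ≤ Mφ) (hφ : ∀ w, ‖φ w‖ ≤ Mφ * ‖w‖) (hMφ' : 0 ≤ Mφ') (hφ' : ∀ X, ‖φ.symm X‖ ≤ Mφ' * ‖X‖)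

omit [Fact (0 < c₀)] [Fact (0 < c₁)] in
/-- Unfolding: the unit-lattice value of `QkW f` at `c` is `φ⁻¹ (Q_k(U)(φ ∘ f))(c)`. [cite: Balaban1985BackgroundPropagators, (3.15) p.393] -/
theorem equiv_QkW_apply (f : BondL2K ℂ d (towerP L m (n + 1)) c₀ W) (c : Bond d m) :
    WL2.equiv ℂ (fun _ : Bond d m => c₁) W (QkW L m n φ U hL α hα1 hU1 hreg (c₀ := c₀) (c₁ := c₁) f) c =
      φ.symm (QkOfU L m hL (n + 1) U α hα1 hU1 hreg (fun b => φ (WL2.equiv ℂ (fun _ : Bond d (towerP L m (n + 1)) => c₀) W f b)) c) := rfl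

include hα0 hφ hMφ' hφ' in
omit [Fact (0 < c₀)] [Fact (0 < c₁)] in
/-- **THE SHARP TOWER `k_{Q,k}`**: `Σ_{j<n+1} α_j ≤ A` ⟹ `‖(Q_k(U)δ_b^u)(c)‖ ≤ M_φ′·((L^{n+1})^d)⁻¹·e^{100d(d+1)L^dA}·M_φ·‖u‖` at EVERY unit-lattice bond `c`, every height.
[folklore] [cite: Balaban1985BackgroundPropagators, (3.15)–(3.16) p.393, (3.35)–(3.37) p.396; Balaban1985Averaging, (125)–(127) pp.36–37] -/
theorem norm_QkW_single_le [DecidableEq (Bond d (towerP L m (n + 1)))] {A : ℝ} (hA : ∑ j ∈ Finset.range (n + 1), α j ≤ A)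
    (b : Bond d (towerP L m (n + 1))) (u : W) (c : Bond d m) :
    ‖WL2.equiv ℂ (fun _ : Bond d m => c₁) W (QkW L m n φ U hL α hα1 hU1 hreg (c₀ := c₀) (c₁ := c₁)
        ((WL2.equiv ℂ (fun _ : Bond d (towerP L m (n + 1)) => c₀) W).symm (Pi.single b u))) c‖ ≤
      Mφ' * ((((L : ℝ) ^ (n + 1)) ^ d)⁻¹ * Real.exp (100 * d * (d + 1) * (L : ℝ) ^ d * A)) * Mφ * ‖u‖ := by
  rw [equiv_QkW_apply, comp_single_eq]
  refine (hφ' _).trans ?_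
  rw [mul_assoc, mul_assoc]
  refine mul_le_mul_of_nonneg_left ?_ hMφ'
  calc ‖QkOfU L m hL (n + 1) U α hα1 hU1 hreg (Pi.single b (φ u)) c‖
      ≤ (((L : ℝ) ^ (n + 1)) ^ d)⁻¹ * Real.exp (100 * d * (d + 1) * (L : ℝ) ^ d * A) * ‖φ u‖ :=
        norm_QkOfU_single_le_heightFree L m hL (n + 1) U α hα0 hα1 hU1 hreg hA b (φ u) c
    _ ≤ (((L : ℝ) ^ (n + 1)) ^ d)⁻¹ * Real.exp (100 * d * (d + 1) * (L : ℝ) ^ d * A) * (Mφ * ‖u‖) :=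
        mul_le_mul_of_nonneg_left (hφ u) (by positivity)

omit [Fact (0 < c₀)] [Fact (0 < c₁)] in
/-- **OFF THE ZONE THE COMPOSITE OF A SPIKE VANISHES**: `(Q_k(U)δ_b^u)(c) = 0` unless the big block `Π(b₋)` of `b` is `c₋` or `c₋ + e_{c.2}`
(`B9Eq315QkLocalLetter.QkOfU_apply_eq_zero_of_support`). [folklore] [cite: Balaban1985Averaging, p.24; Balaban1985BackgroundPropagators, (3.15) p.393] -/
theorem equiv_QkW_single_eq_zero [DecidableEq (Bond d (towerP L m (n + 1)))] (b : Bond d (towerP L m (n + 1))) (u : W) (c : Bond d m)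
    (h1 : c.1 ≠ blockCoord (L ^ (n + 1)) m (siteCast (towerP_eq_fineP_pow L m (n + 1)) b.1))
    (h2 : shift c.2 c.1 ≠ blockCoord (L ^ (n + 1)) m (siteCast (towerP_eq_fineP_pow L m (n + 1)) b.1)) :
    WL2.equiv ℂ (fun _ : Bond d m => c₁) W (QkW L m n φ U hL α hα1 hU1 hreg (c₀ := c₀) (c₁ := c₁)
      ((WL2.equiv ℂ (fun _ : Bond d (towerP L m (n + 1)) => c₀) W).symm (Pi.single b u))) c = 0 := by
  rw [equiv_QkW_apply, comp_single_eq, QkOfU_apply_eq_zero_of_support L m hL (n + 1) U α hα1 hU1 hreg _ _ (fun b' hb' => ?_) c h1 h2, map_zero]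
  have hne : b' ≠ b := fun h => hb' (by rw [h])
  rw [Pi.single_eq_of_ne hne]

variable [FiniteDimensional ℂ W]

include hα0 hMφ hφ hMφ' hφ' in
/-- **THE ADJOINT `Q_k(U)†` POINTWISE FROM LOCAL DATA AT THE SHARP `k_{Q,k}`**: `‖h(c)‖ ≤ M` (`0 ≤ M`) at the unit-lattice bonds `c` with
`Π(b₋) ∈ {c₋, c₋ + e_{c.2}}` (at most `2d`, `card_near_le`) ⟹ `‖(Q_k†h)(b)‖ ≤ (c₁∕c₀)·(M_φ′·((L^{n+1})^d)⁻¹e^{100d(d+1)L^dA}·M_φ)·2d·M` (ne9-leaf-05's generic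
local duality `norm_adjoint_apply_le_local`). [folklore] [cite: Balaban1985BackgroundPropagators, (3.16) p.393, (3.11) p.392; Balaban1985Averaging, p.24, (126)–(127) pp.36–37] -/
theorem norm_adjoint_QkW_apply_le_local_sharp [DecidableEq (Bond d (towerP L m (n + 1)))] {A : ℝ} (hA : ∑ j ∈ Finset.range (n + 1), α j ≤ A)
    (h : BondL2K ℂ d m c₁ W) (b : Bond d (towerP L m (n + 1))) {M : ℝ} (hM : 0 ≤ M)
    (hh : ∀ c : Bond d m, (blockCoord (L ^ (n + 1)) m (siteCast (towerP_eq_fineP_pow L m (n + 1)) b.1) = c.1 ∨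
        blockCoord (L ^ (n + 1)) m (siteCast (towerP_eq_fineP_pow L m (n + 1)) b.1) = shift c.2 c.1) →
      ‖WL2.equiv ℂ (fun _ : Bond d m => c₁) W h c‖ ≤ M) :
    ‖WL2.equiv ℂ (fun _ : Bond d (towerP L m (n + 1)) => c₀) W
        (LinearMap.adjoint (QkW L m n φ U hL α hα1 hU1 hreg (c₀ := c₀) (c₁ := c₁)) h) b‖ ≤
      c₁ / c₀ * (Mφ' * ((((L : ℝ) ^ (n + 1)) ^ d)⁻¹ * Real.exp (100 * d * (d + 1) * (L : ℝ) ^ d * A)) * Mφ) * ((2 * d : ℕ) : ℝ) * M := by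
  classical
  refine norm_adjoint_apply_le_local (QkW L m n φ U hL α hα1 hU1 hreg (c₀ := c₀) (c₁ := c₁)) b
    (fun c : Bond d m => blockCoord (L ^ (n + 1)) m (siteCast (towerP_eq_fineP_pow L m (n + 1)) b.1) = c.1 ∨
      blockCoord (L ^ (n + 1)) m (siteCast (towerP_eq_fineP_pow L m (n + 1)) b.1) = shift c.2 c.1)
    (by positivity) (card_near_le m _) (fun u c hc => ?_)
    (fun u c _ => norm_QkW_single_le L m n φ U hL α hα0 hα1 hU1 hreg hφ hMφ' hφ' hA b u c) h hM hh
  simp only [not_or] at hc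
  exact equiv_QkW_single_eq_zero L m n φ U hL α hα1 hU1 hreg b u c (Ne.symm hc.1) (Ne.symm hc.2)

include hα0 hMφ hφ hMφ' hφ' in
/-- **THE PENALTY `Q_k(U)†(a•Q_k(U))` POINTWISE FROM THE LOCAL VALUES OF `Q_kv`**: `‖(Q_kv)(c)‖ ≤ M` (`0 ≤ M`) on the zone of `b` ⟹
`‖((Q_k†(a•Q_k))v)(b)‖ ≤ |a|·(c₁∕c₀)·k_{Q,k}·2d·M`, `k_{Q,k} = M_φ′·((L^{n+1})^d)⁻¹e^{100d(d+1)L^dA}·M_φ`. [folklore]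
[cite: Balaban1985BackgroundPropagators, (3.16) p.393, (3.26) p.395, (3.11) p.392; Balaban1985Averaging, (126)–(127) pp.36–37] -/
theorem norm_penalty_QkW_apply_le_local_of_values [DecidableEq (Bond d (towerP L m (n + 1)))] {A : ℝ} (hA : ∑ j ∈ Finset.range (n + 1), α j ≤ A)
    (a : ℝ) (v : BondL2K ℂ d (towerP L m (n + 1)) c₀ W) (b : Bond d (towerP L m (n + 1))) {M : ℝ} (hM : 0 ≤ M)
    (hv : ∀ c : Bond d m, (blockCoord (L ^ (n + 1)) m (siteCast (towerP_eq_fineP_pow L m (n + 1)) b.1) = c.1 ∨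
        blockCoord (L ^ (n + 1)) m (siteCast (towerP_eq_fineP_pow L m (n + 1)) b.1) = shift c.2 c.1) →
      ‖WL2.equiv ℂ (fun _ : Bond d m => c₁) W (QkW L m n φ U hL α hα1 hU1 hreg (c₀ := c₀) (c₁ := c₁) v) c‖ ≤ M) :
    ‖WL2.equiv ℂ (fun _ : Bond d (towerP L m (n + 1)) => c₀) W
        ((LinearMap.adjoint (QkW L m n φ U hL α hα1 hU1 hreg (c₀ := c₀) (c₁ := c₁)) ∘ₗ
          ((a : ℂ) • QkW L m n φ U hL α hα1 hU1 hreg (c₀ := c₀) (c₁ := c₁))) v) b‖ ≤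
      |a| * (c₁ / c₀ * (Mφ' * ((((L : ℝ) ^ (n + 1)) ^ d)⁻¹ * Real.exp (100 * d * (d + 1) * (L : ℝ) ^ d * A)) * Mφ) * ((2 * d : ℕ) : ℝ) * M) := by
  rw [LinearMap.comp_apply, LinearMap.smul_apply, LinearMap.map_smul, WL2.equiv_smul, Pi.smul_apply, norm_smul, Complex.norm_real,
    Real.norm_eq_abs]
  refine mul_le_mul_of_nonneg_left ?_ (abs_nonneg a)
  exact norm_adjoint_QkW_apply_le_local_sharp L m n φ U hL α hα0 hα1 hU1 hreg hMφ hφ hMφ' hφ' hA _ b hM hv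

include hα0 hMφ hφ hMφ' hφ' in
/-- **ON THE DIAGONAL `c₀(L^{n+1})^d = c₁` THE PENALTY HAS PRINT's SIZE, HEIGHT-FREE**: `‖((Q_k†(a•Q_k))v)(b)‖ ≤ |a|·M_φ′M_φ·e^{100d(d+1)L^dA}·2d·M` whenever
`‖(Q_kv)(c)‖ ≤ M` on the zone of `b` — NO power of the height `n` (the carriers' `c₁∕c₀ = (L^{n+1})^d` is compensated by the `L^{−(n+1)d}` of `k_{Q,k}`).
[folklore] [cite: Balaban1985BackgroundPropagators, (3.16) p.393, (3.26) p.395, (3.35)–(3.37) p.396; Balaban1985Averaging, (126)–(127) pp.36–37] -/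
theorem norm_penalty_QkW_apply_le_local_of_values_diagonal [DecidableEq (Bond d (towerP L m (n + 1)))] {A : ℝ}
    (hA : ∑ j ∈ Finset.range (n + 1), α j ≤ A) (hw : c₀ * ((L : ℝ) ^ (n + 1)) ^ d = c₁)
    (a : ℝ) (v : BondL2K ℂ d (towerP L m (n + 1)) c₀ W) (b : Bond d (towerP L m (n + 1))) {M : ℝ} (hM : 0 ≤ M)
    (hv : ∀ c : Bond d m, (blockCoord (L ^ (n + 1)) m (siteCast (towerP_eq_fineP_pow L m (n + 1)) b.1) = c.1 ∨
        blockCoord (L ^ (n + 1)) m (siteCast (towerP_eq_fineP_pow L m (n + 1)) b.1) = shift c.2 c.1) →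
      ‖WL2.equiv ℂ (fun _ : Bond d m => c₁) W (QkW L m n φ U hL α hα1 hU1 hreg (c₀ := c₀) (c₁ := c₁) v) c‖ ≤ M) :
    ‖WL2.equiv ℂ (fun _ : Bond d (towerP L m (n + 1)) => c₀) W
        ((LinearMap.adjoint (QkW L m n φ U hL α hα1 hU1 hreg (c₀ := c₀) (c₁ := c₁)) ∘ₗ
          ((a : ℂ) • QkW L m n φ U hL α hα1 hU1 hreg (c₀ := c₀) (c₁ := c₁))) v) b‖ ≤
      |a| * (Mφ' * Mφ * Real.exp (100 * d * (d + 1) * (L : ℝ) ^ d * A) * ((2 * d : ℕ) : ℝ) * M) := by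
  have hc₀ : (0 : ℝ) < c₀ := (Fact.out : (0 : ℝ) < c₀)
  have hLd : (0 : ℝ) < ((L : ℝ) ^ (n + 1)) ^ d := by
    have : (0 : ℝ) < L := by exact_mod_cast hL
    positivity
  have h := norm_penalty_QkW_apply_le_local_of_values (c₁ := c₁) L m n φ U hL α hα0 hα1 hU1 hreg hMφ hφ hMφ' hφ' hA a v b hM hv
  have he : c₁ / c₀ * (Mφ' * ((((L : ℝ) ^ (n + 1)) ^ d)⁻¹ * Real.exp (100 * d * (d + 1) * (L : ℝ) ^ d * A)) * Mφ) =
      Mφ' * Mφ * Real.exp (100 * d * (d + 1) * (L : ℝ) ^ d * A) := by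
    rw [← hw]; field_simp
  rw [he] at h
  exact h

end Carrier

end Literature.MathematicalPhysics.QuantumFieldTheory.Balaban1983to89.B9Eq315QkSingleBondLetter

end
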